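import Summits.FinalStateConjecture.FinalStateConjecture.Theorems.SoloBlindPath
import Literature.Geometry.Lorentzian.TrivialDataAdmissible

/-!
# Solo (blind) — the admissible class parametrised by decay rates and derivative counts (gap G7)

The typed summit `FinalStateConjecture` measures genericity inside
`admissibleVacuumData X`, whose asymptotic clause is the Dafermos–Rodnianski one,
`AFEnd.IsStronglyAsymptoticallyFlatDR e D M = AFEnd.IsStronglyAsymptoticallyFlatWith e D M 1 2 2 1`
(`h - (1 + 2M/r) δ = o₂(r⁻¹)`, `k = o₁(r⁻²)`: two weighted derivatives of `h`, one of `k`). The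
soloist's focal-exceptional-data analysis (paper-level; `SoloBlindFocal` is its kernel half) shows
that with ONLY two weighted derivatives of `h` controlled, the frequency of admissible far-field
gravitational-wave packets is free, and — under a dispersive hypothesis on their future —
conformally corrected imploding `ℓ = 2` Teukolsky shells give admissible data, arbitrarily close
to the trivial data, for which the pointwise final-state property fails through curvature
focusing on the symmetry axis at arbitrarily late times (the sharp one-derivative `L^∞` loss of
the `3`-d wave propagator). With THREE or more weighted derivatives of `h` (in particular with
Christodoulou's own rates, `AFEnd.IsStronglyAsymptoticallyFlatCK = …With (3/2) (5/2) 4 3`,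
Christodoulou–Klainerman (1.0.9)) the construction is impossible.

This file only TYPES the alternatives, so that a ruling on the class can point at declarations:

* `SoloBlindAdmissibleWith X β γ nh nk` — the admissible class with asymptotic clause
  `IsStronglyAsymptoticallyFlatWith e D M β γ nh nk`; `admissibleVacuumData X` is LITERALLY the
  instance `(1, 2, 2, 1)` (`soloBlind_admissibleVacuumData_eq_with`, `rfl`), the CK class is the
  instance `(3/2, 5/2, 4, 3)`; the classes are antitone in all four parameters
  (`soloBlind_admissibleWith_mono`), so CK ⊆ `(1, 2, 3, 2)` ⊆ DR; the trivial data lie in every one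
  of them down from CK (`soloBlind_trivialData_mem_admissibleWith_ck`).
* `SoloBlindFinalStateWith β γ nh nk` — the summit with the class swapped and everything else
  verbatim; `FinalStateConjecture ↔ SoloBlindFinalStateWith 1 2 2 1` (`Iff.rfl`). The two candidate
  re-typings are `SoloBlindFinalStateCK` and `SoloBlindFinalStateSharp` (`(1, 2, 3, 2)`).

NO implication between `SoloBlindFinalStateWith` at different parameters is claimed or expected:
tame genericity asks for escape families INSIDE the class, so shrinking the class removes both
exceptional data and escape routes. Caveat recorded for the ruling: `IsTameDataFamily` /
`AFEnd.wDist` hard-wire the DR weights (`r^{1+m}`, `m ≤ 2`; `r^{2+m}`, `m ≤ 1`); a fully faithful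
re-typing would re-weight the family topology to match the class, which these variants do NOT do
(they change the class only).

References: D. Christodoulou, CQG 16 (1999) A23, p. A24; D. Christodoulou, S. Klainerman (1993),
(1.0.9); M. Dafermos, I. Rodnianski, arXiv:0811.0354, App. B.2.3; W. Littman, J. Math. Mech. 12
(1963) 55; J. Peral, J. Funct. Anal. 36 (1980) 114 (the `L^p` loss of the wave group).
-/

noncomputable section

open Literature.Geometry.Lorentzian Set Asymptotics
open scoped Manifold ContDiff

set_option linter.dupNamespace false

namespace Summit.FinalStateConjecture.FinalStateConjecture.Theorems

section Class

variable (X : Type) [TopologicalSpace X] [ChartedSpace E3 X] [IsManifold (𝓡 3) ∞ X]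

/-- **The admissible class with rates `(β, γ)` and derivative counts `(nh, nk)`**: smooth complete
solutions of the vacuum constraints with a sole asymptotically flat end on which
`h - (1 + 2M/r) δ = o_{nh}(r^{-β})`, `k = o_{nk}(r^{-γ})` for some mass parameter `M`
(`AFEnd.IsStronglyAsymptoticallyFlatWith`). Christodoulou, CQG 16 (1999), p. A24 (the class);
Christodoulou–Klainerman 1993, (1.0.9) and Dafermos–Rodnianski, App. B.2.3 (the two rate choices). -/
def SoloBlindAdmissibleWith (β γ : ℝ) (nh nk : ℕ) : Set (InitialDataSet (𝓡 3) X) :=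
  {D | (∀ [D.metric.HasLeviCivita], D.IsVacuumConstraintSolution ∧ D.IsComplete) ∧
    ∃ (e : AFEnd X) (M : ℝ), e.IsSoleEnd ∧ e.IsStronglyAsymptoticallyFlatWith D M β γ nh nk}

/-- The typed admissible class IS the instance `(β, γ, nh, nk) = (1, 2, 2, 1)` (definitionally).
Dafermos–Rodnianski, arXiv:0811.0354, App. B.2.3. -/
theorem soloBlind_admissibleVacuumData_eq_with :
    admissibleVacuumData X = SoloBlindAdmissibleWith X 1 2 2 1 :=
  rfl

variable {X}

/-- Membership in the instance `(3/2, 5/2, 4, 3)` is admissibility with Christodoulou–Klainerman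
strong asymptotic flatness (`AFEnd.IsStronglyAsymptoticallyFlatCK`), i.e. Christodoulou's 1999
class. Christodoulou–Klainerman 1993, (1.0.9). -/
theorem soloBlind_mem_admissibleWith_ck_iff {D : InitialDataSet (𝓡 3) X} :
    D ∈ SoloBlindAdmissibleWith X (3 / 2) (5 / 2) 4 3 ↔
      (∀ [D.metric.HasLeviCivita], D.IsVacuumConstraintSolution ∧ D.IsComplete) ∧
        ∃ (e : AFEnd X) (M : ℝ), e.IsSoleEnd ∧ e.IsStronglyAsymptoticallyFlatCK D M :=
  Iff.rfl

/-- Strong asymptotic flatness is antitone in the rates and in the derivative counts: faster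
decay with more derivatives controlled implies slower decay with fewer.
Christodoulou–Klainerman 1993, (1.0.9). -/
theorem soloBlind_isStronglyAsymptoticallyFlatWith_mono {e : AFEnd X}
    {D : InitialDataSet (𝓡 3) X} {M β γ β' γ' : ℝ} {nh nk nh' nk' : ℕ}
    (h : e.IsStronglyAsymptoticallyFlatWith D M β γ nh nk) (hβ : β' ≤ β) (hγ : γ' ≤ γ)
    (hh : nh' ≤ nh) (hk : nk' ≤ nk) :
    e.IsStronglyAsymptoticallyFlatWith D M β' γ' nh' nk' :=
  ⟨fun m hm ↦ (h.1 m (hm.trans hh)).trans_isBigO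
      (AFEnd.isBigO_norm_rpow_cobounded (by linarith)),
    fun m hm ↦ (h.2 m (hm.trans hk)).trans_isBigO
      (AFEnd.isBigO_norm_rpow_cobounded (by linarith))⟩

variable (X)

/-- The parametrised admissible classes are antitone in all four parameters.
Christodoulou–Klainerman 1993, (1.0.9). -/
theorem soloBlind_admissibleWith_mono {β γ β' γ' : ℝ} {nh nk nh' nk' : ℕ} (hβ : β' ≤ β)
    (hγ : γ' ≤ γ) (hh : nh' ≤ nh) (hk : nk' ≤ nk) :
    SoloBlindAdmissibleWith X β γ nh nk ⊆ SoloBlindAdmissibleWith X β' γ' nh' nk' := by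
  rintro D ⟨hD, e, M, he, hf⟩
  exact ⟨hD, e, M, he, soloBlind_isStronglyAsymptoticallyFlatWith_mono hf hβ hγ hh hk⟩

/-- CK-admissible data are admissible with three weighted derivatives of `h` and two of `k`
at the DR rates (the minimal re-typing that removes the focal artefact). -/
theorem soloBlind_admissibleWith_ck_subset_sharp :
    SoloBlindAdmissibleWith X (3 / 2) (5 / 2) 4 3 ⊆ SoloBlindAdmissibleWith X 1 2 3 2 :=
  soloBlind_admissibleWith_mono X (by norm_num) (by norm_num) (by norm_num) (by norm_num)

/-- The `(1, 2, 3, 2)` class is contained in the typed (DR) admissible class. -/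
theorem soloBlind_admissibleWith_sharp_subset :
    SoloBlindAdmissibleWith X 1 2 3 2 ⊆ admissibleVacuumData X :=
  soloBlind_admissibleWith_mono X le_rfl le_rfl (by norm_num) (by norm_num)

/-- CK-admissible data are admissible as typed. Christodoulou–Klainerman 1993, (1.0.9);
Dafermos–Rodnianski App. B.2.3. -/
theorem soloBlind_admissibleWith_ck_subset :
    SoloBlindAdmissibleWith X (3 / 2) (5 / 2) 4 3 ⊆ admissibleVacuumData X :=
  (soloBlind_admissibleWith_ck_subset_sharp X).trans (soloBlind_admissibleWith_sharp_subset X)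

end Class

/-- **Anti-vacuity of the CK class**: the trivial data `(ℝ³, δ, 0)` are CK-admissible
(`trivialAFEnd_isStronglyAsymptoticallyFlatCK_holds`). Christodoulou–Klainerman 1993, (1.0.9). -/
theorem soloBlind_trivialData_mem_admissibleWith_ck :
    trivialData ∈ SoloBlindAdmissibleWith Minkowski.slice (3 / 2) (5 / 2) 4 3 :=
  ⟨fun {_} ↦ ⟨trivialData_isVacuumConstraintSolution_holds, isComplete_trivialData_holds⟩,
    trivialAFEnd, 0, isSoleEnd_trivialAFEnd, trivialAFEnd_isStronglyAsymptoticallyFlatCK_holds⟩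

section Summit

/-- **The final state conjecture over the class with rates `(β, γ)` and counts `(nh, nk)`**: the
typed summit with `admissibleVacuumData X` replaced by `SoloBlindAdmissibleWith X β γ nh nk` and
every other clause verbatim (`SoloBlindPointwise` is the statement's pointwise property). The
tame-family topology (`IsTameDataFamily`, `AFEnd.wDist`) is NOT re-weighted here. -/
def SoloBlindFinalStateWith (β γ : ℝ) (nh nk : ℕ) : Prop :=
  ∀ (X : Type) [TopologicalSpace X] [ChartedSpace E3 X] [IsManifold (𝓡 3) ∞ X] [T2Space X]
    [SecondCountableTopology X] [ConnectedSpace X],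
    InitialDataSet.IsTameChristodoulouGeneric (SoloBlindAdmissibleWith X β γ nh nk)
      (SoloBlindPointwise X) 1

/-- The typed summit IS the instance `(1, 2, 2, 1)` of the parametrised family (definitionally). -/
theorem soloBlind_statement_iff_with : FinalStateConjecture ↔ SoloBlindFinalStateWith 1 2 2 1 :=
  Iff.rfl

/-- **Candidate re-typing 1 (Christodoulou's 1999 class)**: the final state conjecture over
CK-admissible data, `h = (1 + 2M/r) δ + o₄(r^{-3/2})`, `k = o₃(r^{-5/2})`. Christodoulou, CQG 16
(1999), p. A24; Christodoulou–Klainerman 1993, (1.0.9). Not claimed comparable with the summit. -/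
def SoloBlindFinalStateCK : Prop :=
  SoloBlindFinalStateWith (3 / 2) (5 / 2) 4 3

/-- **Candidate re-typing 2 (minimal)**: the final state conjecture over data with
`h = (1 + 2M/r) δ + o₃(r⁻¹)`, `k = o₂(r⁻²)` — one more weighted derivative than typed, which is
exactly what the one-derivative `L^∞` loss of the wave propagator consumes. Not claimed
comparable with the summit. -/
def SoloBlindFinalStateSharp : Prop :=
  SoloBlindFinalStateWith 1 2 3 2

/-- Unfolding: the CK re-typing is tame genericity of the statement's pointwise property inside
the CK class on every Cauchy manifold. -/
theorem soloBlind_finalStateCK_iff :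
    SoloBlindFinalStateCK ↔
      ∀ (X : Type) [TopologicalSpace X] [ChartedSpace E3 X] [IsManifold (𝓡 3) ∞ X] [T2Space X]
        [SecondCountableTopology X] [ConnectedSpace X],
        InitialDataSet.IsTameChristodoulouGeneric (SoloBlindAdmissibleWith X (3 / 2) (5 / 2) 4 3)
          (SoloBlindPointwise X) 1 :=
  Iff.rfl

end Summit

end Summit.FinalStateConjecture.FinalStateConjecture.Theorems

end
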